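import Literature.NumberTheory.AdelicBaseChange.PadicTensorCompletionProofs
import HarnessLib

/-!
# The semi-local algebra `ℚ_p ⊗_ℚ L ≅ ∏_{w ∣ p} L_w`, III: `ℤ_p ⊗ 𝓞_L` maps ONTO `∏_w 𝒪_w`

`Proofs` file (theorems only, no definitions, no named facts) in topic
`NumberTheory/AdelicBaseChange`; continuation of `PadicTensorCompletionProofs` (I) and
`PadicTensorCompletionTraceProofs` (II).  For the `ℚ`-algebra isomorphism
`Ψ : ℚ_[p] ⊗[ℚ] L ≃ₐ[ℚ] ∏_{w ∣ v_p} L_w` with `Ψ(s ⊗ x)_w = x · e_p(s)` (part I), part I proved the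
INCLUSION `Ψ(L_int′) ⊆ ∏_w 𝒪_w` for `L_int′ := ℤ_p⟨1 ⊗ b : b ∈ 𝓞_L⟩`; this file proves the
SURJECTIVITY onto `∏_w 𝒪_w`:

* `exists_mem_span_padicTensor_eq` — every `y ∈ ∏_w 𝒪_w` is `Ψ t` for some `t ∈ L_int′`
  (Serre, *Local Fields* II §3 Prop. 4: `B ⊗_A Â_𝔭 = ∏_{𝔓 ∣ 𝔭} B̂_𝔓` for the rings of integers;
  in the tree: the FLT packet's `range_baseChange_comp_tensorAdicCompletionTo_eq_pi`, i.e. the image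
  of `𝓞_L ⊗_{𝓞_ℚ} 𝒪_{v_p}` in `∏ L_w` is exactly `∏ 𝒪_w`, transported along `e_p`).

Hence `Ψ(L_int′) = ∏_w 𝒪_w`, so a lattice `Λ₀ ⊆ ∏_w 𝒪_w` built factor by factor (e.g. the logarithm
lattices `log_ω E₀(L_w)` of the `bsd-addord` SAT₀ argument) pulls back to `Ψ⁻¹(Λ₀) ⊆ L_int′`.  (The
finer statement `Ψ(cycIntLattice p m) = ∏ 𝒪_w` for `L = ℚ(ζ_m)` would need `𝓞_{ℚ(ζ_m)} = ℤ[ζ_m]`,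
in Mathlib only for prime powers `m`; consumers should use `L_int′`.)

## References

* [SerreLocalFields1979] J.-P. Serre, *Local Fields*, GTM 67 (1979), Ch. II §3, Prop. 4.
* [CasselsFrohlichANT1967] Ch. II §10 (10.2).

## Design

No definitions; `Ψ` quantified with its pure-tensor formula.  `noncomputable section`; axioms standard.
-/

noncomputable section

open scoped TensorProduct NumberField
open IsDedekindDomain NumberField

namespace Literature.NumberTheory.AdelicBaseChange

variable {L : Type} [Field L] [NumberField L] {p : ℕ} [Fact p.Prime]

/-- **`Ψ(ℤ_p⟨1 ⊗ 𝓞_L⟩) ⊇ ∏_w 𝒪_w`**: for a `ℚ`-algebra map `Ψ : ℚ_[p] ⊗[ℚ] L → ∏_{w ∣ v_p} L_w` with the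
pure-tensor formula `Ψ(s ⊗ x)_w = x · e_p(s)` and every `y` with `y_w ∈ 𝒪_w` for all `w`, there is
`t` in the `ℤ_p`-span of the `1 ⊗ b`, `b ∈ 𝓞_L`, with `Ψ t = y` (the rings of integers:
`𝓞_L ⊗ ℤ_p ↠ ∏_w 𝒪_w`). [cite: SerreLocalFields1979, Ch. II §3 Prop. 4] -/
theorem exists_mem_span_padicTensor_eq
    (Ψ : ℚ_[p] ⊗[ℚ] L →ₐ[ℚ]
      (Π w : ((Rat.HeightOneSpectrum.primesEquiv (R := 𝓞 ℚ)).symm ⟨p, Fact.out⟩).Extension (𝓞 L),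
        w.1.adicCompletion L))
    (hΨ : ∀ (s : ℚ_[p]) (x : L)
      (w : ((Rat.HeightOneSpectrum.primesEquiv (R := 𝓞 ℚ)).symm ⟨p, Fact.out⟩).Extension (𝓞 L)),
      Ψ (s ⊗ₜ[ℚ] x) w = algebraMap L (w.1.adicCompletion L) x *
        algebraMap (((Rat.HeightOneSpectrum.primesEquiv (R := 𝓞 ℚ)).symm ⟨p, Fact.out⟩).adicCompletion ℚ)
          (w.1.adicCompletion L) (Padic.adicCompletionEquiv (𝓞 ℚ) ⟨p, Fact.out⟩ s))
    (y : Π w : ((Rat.HeightOneSpectrum.primesEquiv (R := 𝓞 ℚ)).symm ⟨p, Fact.out⟩).Extension (𝓞 L),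
      w.1.adicCompletion L)
    (hy : ∀ w, y w ∈ w.1.adicCompletionIntegers L) :
    ∃ t ∈ Submodule.span ℤ_[p] (Set.range fun b : 𝓞 L ↦ (1 : ℚ_[p]) ⊗ₜ[ℚ] (b : L)), Ψ t = y := by
  -- `y` is in the image of `𝓞_L ⊗ 𝒪_v` (the packet)
  have hmem : y ∈ Set.range (HeightOneSpectrum.adicCompletion.baseChange ℚ L (𝓞 L)
      ((Rat.HeightOneSpectrum.primesEquiv (R := 𝓞 ℚ)).symm ⟨p, Fact.out⟩) ∘
      HeightOneSpectrum.tensorAdicCompletionIntegersTo ℚ L (𝓞 L)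
        ((Rat.HeightOneSpectrum.primesEquiv (R := 𝓞 ℚ)).symm ⟨p, Fact.out⟩)) := by
    rw [HeightOneSpectrum.range_baseChange_comp_tensorAdicCompletionTo_eq_pi]
    exact fun w _ ↦ hy w
  obtain ⟨t₀, rfl⟩ := hmem
  -- induction on `t₀ ∈ 𝓞_L ⊗ 𝒪_v`
  induction t₀ using TensorProduct.induction_on with
  | zero =>
    exact ⟨0, Submodule.zero_mem _, by simp⟩
  | tmul b c =>
    -- preimage: `(e_p⁻¹ c) • (1 ⊗ b)`
    let s : ℤ_[p] := (PadicInt.adicCompletionIntegersEquiv (𝓞 ℚ) ⟨p, Fact.out⟩).symm c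
    refine ⟨s • ((1 : ℚ_[p]) ⊗ₜ[ℚ] (b : L)), Submodule.smul_mem _ _ (Submodule.subset_span ⟨b, rfl⟩),
      ?_⟩
    funext w
    have hsmul : (s • ((1 : ℚ_[p]) ⊗ₜ[ℚ] (b : L)) : ℚ_[p] ⊗[ℚ] L) = (s : ℚ_[p]) ⊗ₜ[ℚ] (b : L) := by
      rw [TensorProduct.smul_tmul', Algebra.smul_def, mul_one]
      rfl
    rw [hsmul, hΨ, Function.comp_apply, HeightOneSpectrum.tensorAdicCompletionIntegersTo_tmul,
      HeightOneSpectrum.adicCompletion.baseChange_tmul_apply]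
    congr 1
    -- `e_p (e_p⁻¹ c) = c`
    have h1 : (s : ℚ_[p]) = (Padic.adicCompletionEquiv (𝓞 ℚ) ⟨p, Fact.out⟩).symm (c : _) := by
      rw [← PadicInt.coe_adicCompletionIntegersEquiv_symm_apply]
    rw [h1, ContinuousAlgEquiv.apply_symm_apply]
  | add t₁ t₂ h₁ h₂ =>
    obtain ⟨u₁, hu₁, hu₁'⟩ := h₁ (fun w ↦ by
      have := (HeightOneSpectrum.range_baseChange_comp_tensorAdicCompletionTo_eq_pi ℚ L (𝓞 L)
        ((Rat.HeightOneSpectrum.primesEquiv (R := 𝓞 ℚ)).symm ⟨p, Fact.out⟩)).subset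
        (Set.mem_range_self t₁)
      exact this w trivial)
    obtain ⟨u₂, hu₂, hu₂'⟩ := h₂ (fun w ↦ by
      have := (HeightOneSpectrum.range_baseChange_comp_tensorAdicCompletionTo_eq_pi ℚ L (𝓞 L)
        ((Rat.HeightOneSpectrum.primesEquiv (R := 𝓞 ℚ)).symm ⟨p, Fact.out⟩)).subset
        (Set.mem_range_self t₂)
      exact this w trivial)
    refine ⟨u₁ + u₂, Submodule.add_mem _ hu₁ hu₂, ?_⟩
    rw [map_add, hu₁', hu₂', Function.comp_apply, Function.comp_apply, Function.comp_apply,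
      map_add, map_add]

end Literature.NumberTheory.AdelicBaseChange

end
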